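import Summits.ResolutionOfSingularities.ResolutionOfSingularities.Theorems.WeightedInvariantLocalWeightedDropNCToricRung
import Summits.ResolutionOfSingularities.ResolutionOfSingularities.Theorems.WeightedInvariantLocalWeightedDropNCProductClosure
import Summits.ResolutionOfSingularities.ResolutionOfSingularities.Theorems.WeightedInvariantLocalWeightedDropNCGamePlane

/-!
# W4.3 `LocalWeightedDrop` — TOT rung R7: TAME RELATIVE BINOMIALS (the Jung rung)

OURS · L1 W4.3 · line `nc-game-transport` · strategist res-L1-w43-strat-1 (gen 5) · counted 0.

THE RUNG.  In `m + 2` variables `x_0, …, x_m` (the LEFT block) and one new letter `x_R` (the RIGHT block) consider the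
TAME RELATIVE BINOMIALS
  `P = E · (M · x_R ^ d + h)`,   `E, M, h ∈ k⟦x_0, …, x_m⟧` non-zero,   `p ∤ d` (`(d : k) ≠ 0`).
THEOREM (`totRungTameBinomial_of_toric`, kernel-checked below, 0 sorries): if the mover of the count game wins `E · M · h`
(in `m + 1` variables) within finitely many rounds, then the mover wins `P` (in `m + 2` variables) within finitely many rounds —
modulo three named hypotheses, ALL NOW TREE THEOREMS: `ToricStep (m + 1)` (`NCTransport.toricStep`, p523576, res-D-pv-006),
`ToricEnd (m + 1)` (`NCTransport.toricEnd`, p521013, res-type-088) and the order-growth lemma (O) `OrderGrowth (m + 1)` (statement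
below; content = `NCTransport.order_slice_add_le_of_factor`, p524604, res-D-pv-036 — a one-line glue `orderGrowth : OrderGrowth n`
closes it).  So the CLOSER `totRungTameBinomial (m) : TOTRungTameBinomial m` is three `exact`s away (adoption hand: res-D-pv-036).

COROLLARY (`exists_winsIn_tameSuspension`): at `m = 1`, `E = M = 1`, `h = c(x_0, x_1)` the rung is the TAME SUSPENSION
`x_2 ^ d + c(x_0, x_1)` ((K-c) of stub-1's N = 4 tame census, `TameN4.tot_suspension_tame`, holder res-L1-w43-stub-2) by the landed
plane count `winsIn_plane`; at `m = 2` it produces four-variable wins `x_3 ^ d + c(x_0, x_1, x_2)` from every finitely winnable `c`.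
Internally the right block may have any size `r + 1` (`hM : m + r + 1 = M`, `x_R` = its first letter, idle letters ride along);
the rung instantiates `r = 0` EXPLICITLY (`(r := 0) (M := m + 1) rfl` — the unifier does not solve `m + ?r + 1 = m + 0 + 1`).

CONTENTS.  Part 1 — orders under legal coordinate changes; (O) as a `Prop`; PHASE B end game on UNIT BINOMIALS `v₁ x^α + v₂ x^β`:
`coeff_binomial`, `germIsNC_binomial_of_le`, the Euler certificate `torusSmooth_monomial_add(_left)`, `initForm_binomial`,
`newtonNonDegenerate_binomial`, the uniform toric budget `cloudOf / init_cloud / cloudBudget / boxTop / boxBudget /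
cloudBudget_le_boxBudget` and `winsIn_binomial`.  Part 2 — PHASE A: `relBinom`, `subst_blockExtend_relBinom`,
`subst_chart_blockExtend_relBinom`, `X_dvd_rename_bL_of_X_dvd_add` (killing `y_R`), `not_X_dvd_liftBracket`,
`X_mul_slice_liftTransform`, the budget `rounds`, the induction `winsIn_relBinom`, `exists_winsIn_relBinom`; the rung
`TOTRungTameBinomial`, `totRungTameBinomial_of_toric`; the corollary `exists_winsIn_tameSuspension`.

THE PLAY.  PHASE A (lift): play the `x'`-strategy of `E · M · h` with weight `0` on `x_R` (block extension of the move); the class of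
relative binomials is preserved: at an answer `c` (forced `c_R = 0`) with left transforms `s^{a_E} G_E`, `s^{a_M} G_M`, `s^{a_h} G_h`
the big transform is `s^{a_E + μ} · G_E · (s^{a} G_M · x_R^d + s^{b} G_h)`, `μ = min(a_M, a_h)`, `a + μ = a_M`, `b + μ = a_h`, and the
new position at the live slot `i` is `E' · (M' · x_R^d + h')` with `E' = s · G_E|`, `M' = s^a · G_M|`, `h' = s^b · G_h|` — whose
`x'`-shadow `E' M' h'` divides a power of the `x'`-successor `s · (G_E G_M G_h)|`, so it is won one round sooner (radical transport
`winsIn_of_dvd_pow_at`).  PHASE B (end): when `E M h` is a normal crossing, after its normalising coordinate change (block-extended)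
`P` becomes `v₁ · x^α + v₂ · x^β` with units `v₁, v₂` and `α_R = d`, `β_R = 0`; comparable exponents ⇒ unit · monomial ⇒ NC at once;
incomparable ⇒ NEWTON NON-DEGENERATE (Euler certificate at the slot `R`: `(β_R − α_R) · c₁ x^α = β_R · g − x_R ∂_R g`, and
`α_R − β_R = d` is invertible in `k`) ⇒ won by the toric game R6 (`winsIn_of_cloudWins`).  UNIFORMITY of the round count: the toric
budget is a function of the exponent BOX only (`boxBudget`, by finiteness: a `sup` over the subsets of the box), and the box after
`n` lifted rounds is controlled by the potential `ord E + ord M + ord h ≤ K`, which at most doubles (+1) per round by (O).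
-/

noncomputable section

open Literature.AlgebraicGeometry.Resolution

set_option linter.dupNamespace false -- mandated namespace of this single-conjunct summit

namespace Summit.ResolutionOfSingularities.ResolutionOfSingularities.Theorems

namespace NCTransport

open MvPowerSeries TameFourTupleDrop

variable {k : Type} [Field k]

/-! ## Orders under legal coordinate changes; orders of monomial positions -/

/-- A substitution with zero constant terms does not lower the order. -/
theorem order_le_order_subst_fin {n : ℕ} (a : Fin n → MvPowerSeries (Fin n) k) (ha : ∀ i, constantCoeff (a i) = 0)
    (g : MvPowerSeries (Fin n) k) : g.order ≤ (subst a g).order := by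
  have h1 : (1 : ℕ∞) ≤ ⨅ i, (a i).order := le_iInf fun i => one_le_order_iff_constCoeff_eq_zero.mpr (ha i)
  calc g.order = 1 * g.order := (one_mul _).symm
    _ ≤ (⨅ i, (a i).order) * g.order := mul_le_mul' h1 le_rfl
    _ ≤ _ := le_order_subst (hasSubst_of_constantCoeff_zero ha) g

/-- A legal coordinate change (zero constant terms, invertible linear part) preserves the order (any number of variables). -/
theorem order_subst_of_isUnit_det {n : ℕ} {Φ : Fin n → MvPowerSeries (Fin n) k} (hΦ0 : ∀ i, constantCoeff (Φ i) = 0)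
    (hdet : IsUnit (FormalCoordChange.linMat Φ).det) (f : MvPowerSeries (Fin n) k) : (subst Φ f).order = f.order := by
  refine le_antisymm ?_ (order_le_order_subst_fin Φ hΦ0 f)
  obtain ⟨ψ, hψ0, hψΦ, -⟩ := FormalCoordChange.exists_comp_inverse hΦ0 hdet
  calc (subst Φ f).order ≤ (subst ψ (subst Φ f)).order := order_le_order_subst_fin ψ hψ0 _
    _ = f.order := by
      rw [subst_comp_subst_apply (hasSubst_of_constantCoeff_zero hΦ0) (hasSubst_of_constantCoeff_zero hψ0),
        show (fun s => subst ψ (Φ s)) = X from funext hψΦ, subst_self]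
      rfl

/-- The order of `unit · x^e` is `|e|`. -/
theorem order_unit_mul_prod_X_pow {n : ℕ} {v : MvPowerSeries (Fin n) k} (hv : constantCoeff v ≠ 0) (e : Fin n → ℕ) :
    (v * ∏ i, X i ^ e i).order = ((∑ i, e i : ℕ) : ℕ∞) := by
  have hv0 : v.order = 0 := by
    by_contra h
    exact hv (order_ne_zero_iff_constCoeff_eq_zero.mp h)
  rw [order_mul, hv0, zero_add, MonomialWon.prod_X_pow_eq_monomial, order_monomial_of_ne_zero (one_ne_zero' k),
    Finsupp.degree_eq_sum]
  simp

/-- The order of `x_s ^ a · f` is `a + ord f`. -/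
theorem order_X_pow_mul {n : ℕ} (s : Fin n) (a : ℕ) (f : MvPowerSeries (Fin n) k) :
    (X s ^ a * f).order = (a : ℕ∞) + f.order := by
  rw [order_mul, X_pow_eq, order_monomial_of_ne_zero (one_ne_zero' k), Finsupp.degree_single]

/-! ## (O) Order growth in one round (statement) -/

/-- **(O) ORDER GROWTH IN ONE ROUND** (statement): at an answer `c` of a move with weights `w ≤ 1` and any live slot `i`
(`c_i ≠ 0`), if the transform of `F ≠ 0` is `s^A · G` with `s ∤ G`, then `ord (G|_{y_i = 0}) + A ≤ 2 · ord F`.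
[Proof designed, for the prover: pick `d* ∈ supp F` with `|d*| = ord F`, `b := w·d*`; among the support points `d` with `w·d = b`
agreeing with `d*` on the dead slots take `d°` maximising `Σ_{live j ≠ i} d_j`; the cons-coefficient formula
`CobordantChart.coeff_subst_chart` at the exponent `β = d°` with slot `i` zeroed is the single term `F_{d°} · c_i^{d°_i} ≠ 0`
(binomials `choose d_j β_j` only at `d_j = β_j`, so characteristic-free), whence `ord (G|) ≤ (b − A) + |d°| − d°_i ≤ 2·ord F − A`.] -/
def OrderGrowth (n : ℕ) : Prop :=
  ∀ (k : Type) [Field k] (F : MvPowerSeries (Fin n) k) (w : Fin n → ℕ) (c : Fin n → k),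
    F ≠ 0 → (∀ i, w i = 0 → c i = 0) → (∀ i, w i ≤ 1) →
    ∀ (A : ℕ) (G : MvPowerSeries (Fin (n + 1)) k),
      subst (CobordantChart.chart w c) F = X 0 ^ A * G → ¬ X 0 ∣ G →
      ∀ i, c i ≠ 0 → ∀ o : ℕ, F.order = o → ∃ o' : ℕ, (TupleGame.slice i G).order = o' ∧ o' + A ≤ 2 * o

/-! ## PHASE B — the endgame on a binomial with unit coefficients -/

section EndGame

variable {M : ℕ}

/-- The cloud of a finite exponent set: the value table of its members. -/
def cloudOf (S₀ : Finset (Fin (M + 1) →₀ ℕ)) : ↥S₀ → Fin (M + 1) → ℕ := fun a t => (a : Fin (M + 1) →₀ ℕ) t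

/-- The cloud of the INITIAL toric state on `S₀` is `S₀` itself (independent of the germ). -/
theorem init_cloud (b : MvPowerSeries (Fin (M + 1)) k) (S₀ : Finset (Fin (M + 1) →₀ ℕ)) :
    (ToricState.init b).cloud S₀ = cloudOf S₀ := by
  funext a t
  show ∑ i, (if t = i then 1 else 0) * (a : Fin (M + 1) →₀ ℕ) i = (a : Fin (M + 1) →₀ ℕ) t
  simp

/-- The CLOUD BUDGET of a finite exponent set: a number of rounds within which its cloud is won (`CloudGame.exists_cloudWins`). -/
def cloudBudget (S₀ : Finset (Fin (M + 1) →₀ ℕ)) : ℕ := (CloudGame.exists_cloudWins (cloudOf S₀)).choose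

/-- The cloud of `S₀` is won within its cloud budget. -/
theorem cloudWins_cloudBudget (S₀ : Finset (Fin (M + 1) →₀ ℕ)) : CloudGame.CloudWins (cloudBudget S₀) (cloudOf S₀) :=
  (CloudGame.exists_cloudWins (cloudOf S₀)).choose_spec

/-- The top corner `K · 𝟙` of the box `[0, K]^{M+1}`. -/
def boxTop (M K : ℕ) : Fin (M + 1) →₀ ℕ := Finsupp.equivFunOnFinite.symm fun _ => K

/-- The BOX BUDGET: a number of rounds within which EVERY exponent set inside the box `[0, K]^{M+1}` is won — the `sup` of the cloud
budgets over the (finitely many) subsets of the box. -/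
def boxBudget (M K : ℕ) : ℕ := ((Finset.Icc 0 (boxTop M K)).powerset).sup cloudBudget

/-- The box budget dominates the cloud budget of every exponent set inside the box. -/
theorem cloudBudget_le_boxBudget {K : ℕ} {S₀ : Finset (Fin (M + 1) →₀ ℕ)} (h : ∀ a ∈ S₀, ∀ t, a t ≤ K) :
    cloudBudget S₀ ≤ boxBudget M K := by
  apply Finset.le_sup (f := cloudBudget)
  rw [Finset.mem_powerset]
  intro a ha
  rw [Finset.mem_Icc, Finsupp.le_def, Finsupp.le_def]
  exact ⟨fun t => Nat.zero_le _, fun t => by rw [boxTop, Finsupp.coe_equivFunOnFinite_symm]; exact h a ha t⟩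

/-- The coefficients of a binomial position `v₁ · x^α + v₂ · x^β`. -/
theorem coeff_binomial (v₁ v₂ : MvPowerSeries (Fin (M + 1)) k) (α β γ : Fin (M + 1) →₀ ℕ) :
    coeff γ (v₁ * monomial α 1 + v₂ * monomial β 1) =
      (if α ≤ γ then coeff (γ - α) v₁ else 0) + (if β ≤ γ then coeff (γ - β) v₂ else 0) := by
  classical
  rw [map_add, coeff_mul_monomial, coeff_mul_monomial, mul_one, mul_one]

/-- A binomial position with COMPARABLE distinct exponents and a unit at the smaller one is a unit times a monomial, hence NC. -/
theorem germIsNC_binomial_of_le {v₁ v₂ : MvPowerSeries (Fin (M + 1)) k} (hv₁ : constantCoeff v₁ ≠ 0)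
    {α β : Fin (M + 1) →₀ ℕ} (hle : α ≤ β) (hne : α ≠ β) : GermIsNC (v₁ * monomial α 1 + v₂ * monomial β 1) := by
  classical
  have hδ : β - α ≠ 0 := fun h0 => hne (le_antisymm hle (tsub_eq_zero_iff_le.mp h0))
  have hunit : constantCoeff (v₁ + v₂ * monomial (β - α) (1 : k)) ≠ 0 := by
    rw [map_add, map_mul, ← coeff_zero_eq_constantCoeff_apply (monomial (β - α) (1 : k)), coeff_monomial,
      if_neg (Ne.symm hδ), mul_zero, add_zero]
    exact hv₁
  have heq : v₁ * monomial α 1 + v₂ * monomial β 1 =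
      (v₁ + v₂ * monomial (β - α) (1 : k)) * ∏ i, X i ^ (α : Fin (M + 1) → ℕ) i := by
    rw [MonomialWon.prod_X_pow_eq_monomial, Finsupp.equivFunOnFinite_symm_coe, add_mul, mul_assoc, monomial_mul_monomial, one_mul,
      tsub_add_cancel_of_le hle]
  rw [heq]
  exact ⟨X, _, ⇑α, fun i => constantCoeff_X i, isUnit_det_linMat_perm (Equiv.refl _), hunit, by rw [subst_self]; rfl⟩

/-- Positive weights vanish only at the zero exponent. -/
theorem eq_zero_of_weight_eq_zero {n : ℕ} {w : Fin n → ℕ} (hw : ∀ i, 0 < w i) {δ : Fin n →₀ ℕ}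
    (hδ : Finsupp.weight w δ = 0) : δ = 0 := by
  ext i
  by_contra hi
  have h1 := Finsupp.le_weight_of_ne_zero' w hi
  rw [hδ] at h1
  exact absurd (Nat.le_zero.mp h1) (hw i).ne'

/-- Weights are monotone in the exponent. -/
theorem weight_le_weight_of_le {n : ℕ} (w : Fin n → ℕ) {α γ : Fin n →₀ ℕ} (h : α ≤ γ) :
    Finsupp.weight w α ≤ Finsupp.weight w γ := by
  calc Finsupp.weight w α ≤ Finsupp.weight w α + Finsupp.weight w (γ - α) := Nat.le_add_right _ _
    _ = Finsupp.weight w (α + (γ - α)) := (map_add _ _ _).symm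
    _ = Finsupp.weight w γ := by rw [add_tsub_cancel_of_le h]

/-- Under positive weights, `α ≤ γ` with equal weights forces `γ = α`. -/
theorem eq_of_le_of_weight_eq {n : ℕ} {w : Fin n → ℕ} (hw : ∀ i, 0 < w i) {α γ : Fin n →₀ ℕ} (h : α ≤ γ)
    (heq : Finsupp.weight w γ = Finsupp.weight w α) : γ = α := by
  have h1 : Finsupp.weight w (α + (γ - α)) = Finsupp.weight w α + Finsupp.weight w (γ - α) := map_add _ _ _
  rw [add_tsub_cancel_of_le h, heq] at h1
  have h2 : γ - α = 0 := eq_zero_of_weight_eq_zero hw (by omega)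
  exact le_antisymm (tsub_eq_zero_iff_le.mp h2) h

/-- The Euler operator on a sum of two monomials. -/
theorem eulerOp_monomial_add {n : ℕ} (t : Fin n) (α β : Fin n →₀ ℕ) (c₁ c₂ : k) :
    eulerOp t (monomial α c₁ + monomial β c₂) =
      monomial α (((α t : ℕ) : k) * c₁) + monomial β (((β t : ℕ) : k) * c₂) := by
  classical
  ext γ
  show ((γ t : ℕ) : k) * coeff γ (monomial α c₁ + monomial β c₂) = _
  simp only [map_add, coeff_monomial]
  split_ifs <;> subst_vars <;> ring

/-- THE EULER CERTIFICATE: a sum of two monomials `c₁ x^α + c₂ x^β` with `c₁ ≠ 0` and a slot `t` with `α_t ≠ β_t` IN `k` is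
torus-smooth — `(β_t − α_t) · c₁ x^α = β_t · g − x_t ∂_t g` lies in the log-Jacobian ideal, so `x^α` does, so a power of `x_0 ⋯ x_{n-1}`
does. -/
theorem torusSmooth_monomial_add_left {n : ℕ} {c₁ : k} (hc₁ : c₁ ≠ 0) (c₂ : k) {α β : Fin n →₀ ℕ} (t : Fin n)
    (hsep : ((α t : ℕ) : k) ≠ ((β t : ℕ) : k)) : TorusSmooth (monomial α c₁ + monomial β c₂) := by
  classical
  set g : MvPowerSeries (Fin n) k := monomial α c₁ + monomial β c₂ with hg
  set I : Ideal (MvPowerSeries (Fin n) k) := Ideal.span (insert g (Set.range fun i => eulerOp i g)) with hI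
  have hgI : g ∈ I := Ideal.subset_span (Set.mem_insert _ _)
  have heI : eulerOp t g ∈ I := Ideal.subset_span (Set.mem_insert_of_mem _ ⟨t, rfl⟩)
  set κ : k := (((β t : ℕ) : k) - ((α t : ℕ) : k)) * c₁ with hκ
  have hκ0 : κ ≠ 0 := mul_ne_zero (sub_ne_zero.mpr hsep.symm) hc₁
  have hr : monomial 0 ((β t : ℕ) : k) * g - eulerOp t g = monomial α κ := by
    rw [hg, eulerOp_monomial_add, mul_add, monomial_mul_monomial, monomial_mul_monomial, zero_add, zero_add, hκ, sub_mul,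
      map_sub]
    abel
  have hαI : monomial α κ ∈ I := hr ▸ I.sub_mem (I.mul_mem_left _ hgI) heI
  have h1I : monomial α (1 : k) ∈ I := by
    have h1 : monomial α (1 : k) = monomial 0 κ⁻¹ * monomial α κ := by
      rw [monomial_mul_monomial, zero_add, inv_mul_cancel₀ hκ0]
    rw [h1]
    exact I.mul_mem_left _ hαI
  refine ⟨α.degree, ?_⟩
  have hle : α ≤ Finsupp.equivFunOnFinite.symm (fun _ : Fin n => α.degree) :=
    Finsupp.le_def.mpr fun i => by rw [Finsupp.coe_equivFunOnFinite_symm]; exact Finsupp.le_degree i α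
  have hprod : (∏ i, (X i : MvPowerSeries (Fin n) k)) ^ α.degree =
      monomial (Finsupp.equivFunOnFinite.symm (fun _ : Fin n => α.degree) - α) 1 * monomial α (1 : k) := by
    rw [← Finset.prod_pow, MonomialWon.prod_X_pow_eq_monomial (fun _ : Fin n => α.degree), monomial_mul_monomial, mul_one,
      tsub_add_cancel_of_le hle]
  rw [hprod]
  exact I.mul_mem_left _ h1I

/-- The Euler certificate, either coefficient non-zero. -/
theorem torusSmooth_monomial_add {n : ℕ} {c₁ c₂ : k} (hc : c₁ ≠ 0 ∨ c₂ ≠ 0) {α β : Fin n →₀ ℕ} (t : Fin n)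
    (hsep : ((α t : ℕ) : k) ≠ ((β t : ℕ) : k)) : TorusSmooth (monomial α c₁ + monomial β c₂) := by
  rcases hc with hc₁ | hc₂
  · exact torusSmooth_monomial_add_left hc₁ c₂ t hsep
  · rw [add_comm (monomial α c₁)]
    exact torusSmooth_monomial_add_left hc₂ c₁ t hsep.symm

/-- THE INITIAL FORMS OF A BINOMIAL POSITION with incomparable exponents, for a positive weight: `c₁ x^α`, `c₂ x^β` or their sum,
according to the weights of `α` and `β` (`cᵢ` = the constant terms of the unit coefficients). -/
theorem initForm_binomial {v₁ v₂ : MvPowerSeries (Fin (M + 1)) k} (hv₁ : constantCoeff v₁ ≠ 0) (hv₂ : constantCoeff v₂ ≠ 0)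
    {α β : Fin (M + 1) →₀ ℕ} (hαβ : ¬ α ≤ β) (hβα : ¬ β ≤ α) {w : Fin (M + 1) → ℕ} (hw : ∀ i, 0 < w i) :
    initForm w (v₁ * monomial α 1 + v₂ * monomial β 1) =
      monomial α (if Finsupp.weight w α ≤ Finsupp.weight w β then constantCoeff v₁ else 0) +
        monomial β (if Finsupp.weight w β ≤ Finsupp.weight w α then constantCoeff v₂ else 0) := by
  classical
  set Q := v₁ * monomial α 1 + v₂ * monomial β 1 with hQ
  set a := Finsupp.weight w α with ha
  set b := Finsupp.weight w β with hb
  have hne : α ≠ β := fun h => hαβ (h ▸ le_rfl)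
  have hcoα : coeff α Q = constantCoeff v₁ := by
    rw [hQ, coeff_binomial, if_pos le_rfl, if_neg hβα, tsub_self, coeff_zero_eq_constantCoeff_apply, add_zero]
  have hcoβ : coeff β Q = constantCoeff v₂ := by
    rw [hQ, coeff_binomial, if_neg hαβ, if_pos le_rfl, tsub_self, coeff_zero_eq_constantCoeff_apply, zero_add]
  have hsupp : ∀ γ, coeff γ Q ≠ 0 → α ≤ γ ∨ β ≤ γ := by
    intro γ hγ
    by_contra hno
    push Not at hno
    rw [hQ, coeff_binomial, if_neg hno.1, if_neg hno.2, add_zero] at hγ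
    exact hγ rfl
  -- the weighted order is `min a b`
  have hord : weightedOrder w Q = ((min a b : ℕ) : ℕ∞) := by
    rw [weightedOrder_eq_nat]
    refine ⟨?_, fun γ hγ => ?_⟩
    · rcases le_total a b with hab | hab
      · exact ⟨α, by rw [hcoα]; exact hv₁, by rw [min_eq_left hab]⟩
      · exact ⟨β, by rw [hcoβ]; exact hv₂, by rw [min_eq_right hab]⟩
    · by_contra hγ0
      rcases hsupp γ hγ0 with h | h
      · exact absurd (lt_of_lt_of_le hγ (min_le_left a b)) (not_lt.mpr (weight_le_weight_of_le w h))
      · exact absurd (lt_of_lt_of_le hγ (min_le_right a b)) (not_lt.mpr (weight_le_weight_of_le w h))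
  clear_value Q
  ext γ
  show (if ((Finsupp.weight w γ : ℕ) : ℕ∞) = weightedOrder w Q then coeff γ Q else 0) = _
  rw [hord, map_add, coeff_monomial, coeff_monomial]
  by_cases hγ : Finsupp.weight w γ = min a b
  · rw [if_pos (show ((Finsupp.weight w γ : ℕ) : ℕ∞) = ((min a b : ℕ) : ℕ∞) by rw [hγ]), hQ, coeff_binomial]
    congr 1
    · by_cases hαγ : α ≤ γ
      · have h1 : a ≤ Finsupp.weight w γ := weight_le_weight_of_le w hαγ
        rw [hγ] at h1
        have hmin : min a b = a := le_antisymm (min_le_left a b) h1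
        have hγα : γ = α := eq_of_le_of_weight_eq hw hαγ (by rw [hγ, hmin])
        subst hγα
        rw [if_pos le_rfl, if_pos rfl, tsub_self, coeff_zero_eq_constantCoeff_apply, if_pos (min_eq_left_iff.mp hmin)]
      · have hγα : γ ≠ α := fun h => hαγ (h ▸ le_rfl)
        rw [if_neg hαγ, if_neg hγα]
    · by_cases hβγ : β ≤ γ
      · have h1 : b ≤ Finsupp.weight w γ := weight_le_weight_of_le w hβγ
        rw [hγ] at h1
        have hmin : min a b = b := le_antisymm (min_le_right a b) h1
        have hγβ : γ = β := eq_of_le_of_weight_eq hw hβγ (by rw [hγ, hmin])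
        subst hγβ
        rw [if_pos le_rfl, if_pos rfl, tsub_self, coeff_zero_eq_constantCoeff_apply, if_pos (min_eq_right_iff.mp hmin)]
      · have hγβ : γ ≠ β := fun h => hβγ (h ▸ le_rfl)
        rw [if_neg hβγ, if_neg hγβ]
  · rw [if_neg (fun h => hγ (by exact_mod_cast h))]
    symm
    have h1 : (if γ = α then (if a ≤ b then constantCoeff v₁ else 0) else 0) = 0 := by
      split_ifs with h1 h2
      · exact absurd (by rw [h1, min_eq_left h2]) hγ
      · rfl
      · rfl
    have h2 : (if γ = β then (if b ≤ a then constantCoeff v₂ else 0) else 0) = 0 := by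
      split_ifs with h1 h2
      · exact absurd (by rw [h1, min_eq_right h2]) hγ
      · rfl
      · rfl
    rw [h1, h2, add_zero]

/-- A BINOMIAL POSITION WITH UNIT COEFFICIENTS, INCOMPARABLE EXPONENTS AND A SEPARATING SLOT IS NEWTON NON-DEGENERATE. -/
theorem newtonNonDegenerate_binomial {v₁ v₂ : MvPowerSeries (Fin (M + 1)) k} (hv₁ : constantCoeff v₁ ≠ 0)
    (hv₂ : constantCoeff v₂ ≠ 0) {α β : Fin (M + 1) →₀ ℕ} (hαβ : ¬ α ≤ β) (hβα : ¬ β ≤ α)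
    (hsep : ∃ t, ((α t : ℕ) : k) ≠ ((β t : ℕ) : k)) : NewtonNonDegenerate (v₁ * monomial α 1 + v₂ * monomial β 1) := by
  intro w hw
  obtain ⟨t, ht⟩ := hsep
  rw [initForm_binomial hv₁ hv₂ hαβ hβα hw]
  refine torusSmooth_monomial_add ?_ t ht
  rcases le_total (Finsupp.weight w α) (Finsupp.weight w β) with h | h
  · exact Or.inl (by rw [if_pos h]; exact hv₁)
  · exact Or.inr (by rw [if_pos h]; exact hv₂)

/-- **PHASE B — THE END LEMMA.**  A binomial position `v₁ · x^α + v₂ · x^β` with unit coefficients, a separating slot (`α_t ≠ β_t`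
in `k`) and exponents in the box `[0, K]^{M+1}` is won within `boxBudget M K` rounds — at once if the exponents are comparable,
by the toric game (R6: `ToricStep`, `ToricEnd`) from the initial state on the covering set `{α, β}` otherwise. -/
theorem winsIn_binomial (hstep : ToricStep M) (hend : ToricEnd M) {v₁ v₂ : MvPowerSeries (Fin (M + 1)) k}
    (hv₁ : constantCoeff v₁ ≠ 0) (hv₂ : constantCoeff v₂ ≠ 0) {α β : Fin (M + 1) →₀ ℕ}
    (hsep : ∃ t, ((α t : ℕ) : k) ≠ ((β t : ℕ) : k)) {K : ℕ} (hK : ∀ t, α t ≤ K ∧ β t ≤ K) :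
    WinsIn (m := M) GermIsNC (boxBudget M K) (v₁ * monomial α 1 + v₂ * monomial β 1) := by
  classical
  have hne : α ≠ β := by
    obtain ⟨t, ht⟩ := hsep
    rintro rfl
    exact ht rfl
  by_cases hle : α ≤ β
  · exact winsIn_done (germIsNC_binomial_of_le hv₁ hle hne) _
  by_cases hge : β ≤ α
  · rw [add_comm (v₁ * monomial α 1)]
    exact winsIn_done (germIsNC_binomial_of_le hv₂ hge (Ne.symm hne)) _
  set Q := v₁ * monomial α 1 + v₂ * monomial β 1 with hQ
  have hcov : Covers Q {α, β} := by
    refine ⟨fun a ha => ?_, fun γ hγ => ?_⟩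
    · rcases Finset.mem_insert.mp ha with rfl | ha
      · rw [hQ, coeff_binomial, if_pos le_rfl, if_neg hge, tsub_self, coeff_zero_eq_constantCoeff_apply, add_zero]; exact hv₁
      · rw [Finset.mem_singleton] at ha
        subst ha
        rw [hQ, coeff_binomial, if_neg hle, if_pos le_rfl, tsub_self, coeff_zero_eq_constantCoeff_apply, zero_add]; exact hv₂
    · by_contra hno
      push Not at hno
      have h1 : ¬ α ≤ γ := fun h => hno α (by simp) h
      have h2 : ¬ β ≤ γ := fun h => hno β (by simp) h
      rw [hQ, coeff_binomial, if_neg h1, if_neg h2, add_zero] at hγ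
      exact hγ rfl
  have hND : NewtonNonDegenerate Q := newtonNonDegenerate_binomial hv₁ hv₂ hle hge hsep
  have hS : ({α, β} : Finset (Fin (M + 1) →₀ ℕ)).Nonempty := ⟨α, by simp⟩
  have hw := winsIn_of_cloudWins hstep hend hND hcov hS (cloudBudget {α, β}) Q (ToricState.init Q)
    (by rw [init_cloud]; exact cloudWins_cloudBudget _)
  refine WinsIn.mono (cloudBudget_le_boxBudget fun a ha t => ?_) hw
  rcases Finset.mem_insert.mp ha with rfl | ha
  · exact (hK t).1
  · rw [Finset.mem_singleton] at ha
    subst ha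
    exact (hK t).2

end EndGame

end NCTransport

end Summit.ResolutionOfSingularities.ResolutionOfSingularities.Theorems
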